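import Summits.FinalStateConjecture.FinalStateConjecture.Theorems.EIHFluxBalanceInertialRecessionClamp
import Mathlib.Analysis.InnerProductSpace.Calculus
import Mathlib.Analysis.InnerProductSpace.PiL2
import Literature.Geometry.Lorentzian.Basic

/-!
# Route EIHFluxBalance — `InertialRecession`: the coordinate clamp field on `E3`

Helper file for the crux `stmt-FinalStateConjecture-10166`
(`Summit.FinalStateConjecture.FinalStateConjecture.Theses.EIHFluxBalance.InertialRecession`).

The hole charts of the re-charting must be defined on WHOLE boosted Kerr exteriors, but far
from the hole the naive Fermi-type placement runs into the other holes (where the lab chart is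
not defined). The rest offsets are therefore clamped, at lab time `t`, into the cube of side
`2ρ(t)` by the **coordinate clamp field** `g(t, z) = ρ(t) · (G̃(z₁/ρ(t)), G̃(z₂/ρ(t)), G̃(z₃/ρ(t)))`
built from the two-sided clamp `G̃` of `…Clamp` (`exists_coordClamp`) and a smooth radius
function `ρ > 0`. This file records its properties, in the form consumed by
`isOpenEmbedding_fibred` (`…Fibred`): joint smoothness, fibrewise injectivity, injectivity of
the fibre differentials (`G̃' > 0`), `g(t, z) = z` on the ball `‖z‖ ≤ ρ(t)/2` (where the chart is
honest), `‖g(t, z)‖ < 2ρ(t)` (the image stays near the hole) and `min(‖z‖, ρ(t)/2) ≤ ‖g(t, z)‖`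
(the image stays off the horizon).
-/

noncomputable section

open scoped Topology ContDiff
open Filter Set Function Literature.Geometry.Lorentzian

namespace Summit.FinalStateConjecture.FinalStateConjecture.Theorems

section ClampField

variable {Gt : ℝ → ℝ} {ρ : ℝ → ℝ}

/-- Coordinates of the clamp field: `g(t, z)_k = ρ(t) G̃(z_k/ρ(t))`. [folklore] -/
theorem clampField_apply (t : ℝ) (z : E3) (k : Fin 3) :
    (ρ t • (WithLp.toLp 2 fun k ↦ Gt ((ρ t)⁻¹ * z k) : E3)) k = ρ t * Gt ((ρ t)⁻¹ * z k) := by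
  simp

/-- The clamp field is jointly smooth (for smooth `G̃` and smooth `ρ > 0`). [folklore] -/
theorem contDiff_clampField (hGt : ContDiff ℝ ∞ Gt) (hρ : ContDiff ℝ ∞ ρ) (hρ0 : ∀ t, 0 < ρ t) :
    ContDiff ℝ ∞ fun p : ℝ × E3 ↦
      (ρ p.1 • (WithLp.toLp 2 fun k ↦ Gt ((ρ p.1)⁻¹ * p.2 k) : E3)) := by
  have hρ1 : ContDiff ℝ ∞ fun p : ℝ × E3 ↦ ρ p.1 := hρ.comp contDiff_fst
  have hρi : ContDiff ℝ ∞ fun p : ℝ × E3 ↦ (ρ p.1)⁻¹ := hρ1.inv fun p ↦ (hρ0 p.1).ne'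
  refine hρ1.smul ?_
  refine contDiff_euclidean.mpr fun k ↦ ?_
  have hk : ContDiff ℝ ∞ fun p : ℝ × E3 ↦ p.2 k :=
    (EuclideanSpace.proj k : E3 →L[ℝ] ℝ).contDiff.comp contDiff_snd
  exact hGt.comp (hρi.mul hk)

/-- Each fibre map `z ↦ g(t, z)` is injective (`G̃` is strictly monotone). [folklore] -/
theorem injective_clampField (hGm : StrictMono Gt) (hρ0 : ∀ t, 0 < ρ t) (t : ℝ) :
    Injective fun z : E3 ↦ (ρ t • (WithLp.toLp 2 fun k ↦ Gt ((ρ t)⁻¹ * z k) : E3)) := by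
  intro z z' h
  ext k
  have hk := congrArg (fun w : E3 ↦ w k) h
  simp only [clampField_apply] at hk
  have h1 : Gt ((ρ t)⁻¹ * z k) = Gt ((ρ t)⁻¹ * z' k) := mul_left_cancel₀ (hρ0 t).ne' hk
  have h2 := hGm.injective h1
  exact mul_left_cancel₀ (inv_ne_zero (hρ0 t).ne') h2

/-- Each fibre differential `D(g t)(z)` is injective (`G̃' > 0`: it is diagonal with positive
entries `G̃'(z_k/ρ)`). [folklore] -/
theorem injective_fderiv_clampField' (hGt : ContDiff ℝ ∞ Gt) (hGd : ∀ u, 0 < deriv Gt u)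
    (hρ : ContDiff ℝ ∞ ρ) (hρ0 : ∀ t, 0 < ρ t) (t : ℝ) (z : E3) :
    Injective (fderiv ℝ (fun z : E3 ↦ (ρ t • (WithLp.toLp 2 fun k ↦ Gt ((ρ t)⁻¹ * z k) : E3))) z) := by
  set g : E3 → E3 := fun z ↦ ρ t • (WithLp.toLp 2 fun k ↦ Gt ((ρ t)⁻¹ * z k) : E3) with hg
  have hgc : ContDiff ℝ ∞ g := by
    have := contDiff_clampField hGt hρ hρ0
    exact this.comp (contDiff_const.prodMk contDiff_id)
  have hgd : DifferentiableAt ℝ g z := (hgc.differentiable (by simp)).differentiableAt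
  -- coordinate `k` of the differential
  have hcoord : ∀ (k : Fin 3) (δ : E3),
      (fderiv ℝ g z δ) k = deriv Gt ((ρ t)⁻¹ * z k) * δ k := by
    intro k δ
    have h1 : fderiv ℝ (fun w ↦ g w k) z = (EuclideanSpace.proj k : E3 →L[ℝ] ℝ).comp (fderiv ℝ g z) :=
      ((EuclideanSpace.proj k : E3 →L[ℝ] ℝ).hasFDerivAt.comp z hgd.hasFDerivAt).fderiv
    have hGdiff : Differentiable ℝ Gt := hGt.differentiable (by simp)
    have h2 : HasDerivAt (fun s : ℝ ↦ ρ t * Gt ((ρ t)⁻¹ * s))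
        (ρ t * (deriv Gt ((ρ t)⁻¹ * z k) * ((ρ t)⁻¹ * 1))) (z k) :=
      (((hGdiff _).hasDerivAt).comp (z k) ((hasDerivAt_id (z k)).const_mul _)).const_mul (ρ t)
    have h3 := h2.comp_hasFDerivAt z ((EuclideanSpace.proj k : E3 →L[ℝ] ℝ).hasFDerivAt)
    have hfun : (fun w ↦ g w k) =
        (fun s : ℝ ↦ ρ t * Gt ((ρ t)⁻¹ * s)) ∘ (EuclideanSpace.proj k : E3 →L[ℝ] ℝ) :=
      funext fun w ↦ clampField_apply t w k
    have h4 := DFunLike.congr_fun (h1.symm.trans (hfun ▸ h3.fderiv)) δ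
    simp only [ContinuousLinearMap.comp_apply, smul_apply, smul_eq_mul] at h4
    rw [show (EuclideanSpace.proj k : E3 →L[ℝ] ℝ) (fderiv ℝ g z δ) = (fderiv ℝ g z δ) k from rfl,
      show (EuclideanSpace.proj k : E3 →L[ℝ] ℝ) δ = δ k from rfl] at h4
    rw [h4]
    field_simp [(hρ0 t).ne']
  intro δ δ' h
  rw [← sub_eq_zero] at h ⊢
  rw [← map_sub] at h
  ext k
  have hk := congrArg (fun w : E3 ↦ w k) h
  simp only at hk
  rw [hcoord k] at hk
  rcases mul_eq_zero.mp hk with h0 | h0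
  · exact absurd h0 (hGd _).ne'
  · simpa using h0

/-- On the ball `‖z‖ ≤ ρ(t)/2` the clamp field is the identity. [folklore] -/
theorem clampField_eq_self (hGid : ∀ u, |u| ≤ 1 / 2 → Gt u = u) (hρ0 : ∀ t, 0 < ρ t) (t : ℝ)
    {z : E3} (hz : ‖z‖ ≤ ρ t / 2) :
    (ρ t • (WithLp.toLp 2 fun k ↦ Gt ((ρ t)⁻¹ * z k) : E3)) = z := by
  ext k
  rw [clampField_apply]
  have hk : |z k| ≤ ‖z‖ := by
    have := PiLp.norm_apply_le z k
    rwa [Real.norm_eq_abs] at this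
  have h1 : |(ρ t)⁻¹ * z k| ≤ 1 / 2 := by
    rw [abs_mul, abs_inv, abs_of_pos (hρ0 t)]
    rw [inv_mul_le_iff₀ (hρ0 t)]
    linarith
  rw [hGid _ h1]
  field_simp [(hρ0 t).ne']

/-- The clamp field lands in the cube: `‖g(t, z)‖ < 2ρ(t)` (`|G̃| < 1` coordinatewise,
`√3 < 2`). [folklore] -/
theorem norm_clampField_lt (hGlt : ∀ u, |Gt u| < 1) (hρ0 : ∀ t, 0 < ρ t) (t : ℝ) (z : E3) :
    ‖(ρ t • (WithLp.toLp 2 fun k ↦ Gt ((ρ t)⁻¹ * z k) : E3))‖ < 2 * ρ t := by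
  set w : E3 := ρ t • (WithLp.toLp 2 fun k ↦ Gt ((ρ t)⁻¹ * z k) : E3) with hw
  have hk : ∀ k, ‖w k‖ ^ 2 ≤ ρ t ^ 2 := by
    intro k
    rw [hw, clampField_apply, Real.norm_eq_abs, abs_mul, abs_of_pos (hρ0 t)]
    have := hGlt ((ρ t)⁻¹ * z k)
    have h0 : 0 ≤ |Gt ((ρ t)⁻¹ * z k)| := abs_nonneg _
    have h1 : |Gt ((ρ t)⁻¹ * z k)| ^ 2 ≤ 1 ^ 2 := pow_le_pow_left₀ h0 this.le 2
    calc (ρ t * |Gt ((ρ t)⁻¹ * z k)|) ^ 2 = ρ t ^ 2 * |Gt ((ρ t)⁻¹ * z k)| ^ 2 := by ring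
      _ ≤ ρ t ^ 2 * 1 ^ 2 := mul_le_mul_of_nonneg_left h1 (sq_nonneg _)
      _ = ρ t ^ 2 := by ring
  have hsum : ∑ k : Fin 3, ‖w k‖ ^ 2 ≤ 3 * ρ t ^ 2 := by
    calc ∑ k : Fin 3, ‖w k‖ ^ 2 ≤ ∑ _k : Fin 3, ρ t ^ 2 := Finset.sum_le_sum fun k _ ↦ hk k
      _ = 3 * ρ t ^ 2 := by simp
  rw [EuclideanSpace.norm_eq]
  calc √(∑ k : Fin 3, ‖w k‖ ^ 2) ≤ √(3 * ρ t ^ 2) := Real.sqrt_le_sqrt hsum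
    _ < 2 * ρ t := by
        rw [Real.sqrt_lt' (by linarith [hρ0 t])]
        nlinarith [hρ0 t]

/-- The clamp field stays off the centre: `min(‖z‖, ρ(t)/2) ≤ ‖g(t, z)‖` (either all
`|z_k| ≤ ρ/2` and `g(t, z) = z`, or some `|g(t, z)_k| > ρ/2`). [folklore] -/
theorem min_le_norm_clampField' (hGid : ∀ u, |u| ≤ 1 / 2 → Gt u = u)
    (hGgt : ∀ u, 1 / 2 < |u| → 1 / 2 < |Gt u|) (hρ0 : ∀ t, 0 < ρ t) (t : ℝ) (z : E3) :
    min ‖z‖ (ρ t / 2) ≤ ‖(ρ t • (WithLp.toLp 2 fun k ↦ Gt ((ρ t)⁻¹ * z k) : E3))‖ := by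
  set w : E3 := ρ t • (WithLp.toLp 2 fun k ↦ Gt ((ρ t)⁻¹ * z k) : E3) with hw
  by_cases h : ∀ k : Fin 3, |z k| ≤ ρ t / 2
  · -- all coordinates small: `g = z`
    have hwz : w = z := by
      ext k
      rw [hw, clampField_apply]
      have h1 : |(ρ t)⁻¹ * z k| ≤ 1 / 2 := by
        rw [abs_mul, abs_inv, abs_of_pos (hρ0 t), inv_mul_le_iff₀ (hρ0 t)]
        linarith [h k]
      rw [hGid _ h1]
      field_simp [(hρ0 t).ne']
    rw [hwz]
    exact min_le_left _ _
  · obtain ⟨k, hk⟩ := not_forall.mp h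
    have hk : ρ t / 2 < |z k| := not_le.mp hk
    have h1 : 1 / 2 < |(ρ t)⁻¹ * z k| := by
      rw [abs_mul, abs_inv, abs_of_pos (hρ0 t), lt_inv_mul_iff₀ (hρ0 t)]
      linarith
    have h2 := hGgt _ h1
    have h3 : ρ t / 2 < ‖w k‖ := by
      rw [hw, clampField_apply, Real.norm_eq_abs, abs_mul, abs_of_pos (hρ0 t)]
      have := mul_lt_mul_of_pos_left h2 (hρ0 t)
      linarith
    have h4 : ‖w k‖ ≤ ‖w‖ := PiLp.norm_apply_le w k
    exact (min_le_right _ _).trans (h3.le.trans h4)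

/-- The clamp field is norm non-increasing coordinatewise: `‖g(t, z)‖ ≤ ‖z‖` (`|G̃ u| ≤ |u|`).
[folklore] -/
theorem norm_clampField_le (hGle : ∀ u, |Gt u| ≤ |u|) (hρ0 : ∀ t, 0 < ρ t) (t : ℝ) (z : E3) :
    ‖(ρ t • (WithLp.toLp 2 fun k ↦ Gt ((ρ t)⁻¹ * z k) : E3))‖ ≤ ‖z‖ := by
  set w : E3 := ρ t • (WithLp.toLp 2 fun k ↦ Gt ((ρ t)⁻¹ * z k) : E3) with hw
  have hk : ∀ k, ‖w k‖ ^ 2 ≤ ‖z k‖ ^ 2 := by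
    intro k
    rw [hw, clampField_apply, Real.norm_eq_abs, Real.norm_eq_abs, abs_mul, abs_of_pos (hρ0 t)]
    have h1 := hGle ((ρ t)⁻¹ * z k)
    rw [abs_mul, abs_inv, abs_of_pos (hρ0 t)] at h1
    have h2 : ρ t * |Gt ((ρ t)⁻¹ * z k)| ≤ |z k| := by
      have := mul_le_mul_of_nonneg_left h1 (hρ0 t).le
      rwa [← mul_assoc, mul_inv_cancel₀ (hρ0 t).ne', one_mul] at this
    have h0 : 0 ≤ ρ t * |Gt ((ρ t)⁻¹ * z k)| := mul_nonneg (hρ0 t).le (abs_nonneg _)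
    nlinarith
  rw [EuclideanSpace.norm_eq, EuclideanSpace.norm_eq]
  exact Real.sqrt_le_sqrt (Finset.sum_le_sum fun k _ ↦ hk k)

end ClampField

/-! ### Registered forms -/

/-- Registered sub-goal form (stub `injective_fderiv_clampField` of the crux item) of
`injective_fderiv_clampField'`. [folklore] -/
theorem injective_fderiv_clampField : ∀ {Gt ρ : ℝ → ℝ}, ContDiff ℝ ((⊤ : ℕ∞) : WithTop ℕ∞) Gt → (∀ u, 0 < deriv Gt u) → ContDiff ℝ ((⊤ : ℕ∞) : WithTop ℕ∞) ρ → (∀ t, 0 < ρ t) → ∀ (t : ℝ) (z : E3), Function.Injective (fderiv ℝ (fun z : E3 ↦ (ρ t • (WithLp.toLp 2 fun k ↦ Gt ((ρ t)⁻¹ * z k) : E3))) z) :=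
  fun hGt hGd hρ hρ0 t z ↦ injective_fderiv_clampField' hGt hGd hρ hρ0 t z

/-- Registered sub-goal form (stub `min_le_norm_clampField` of the crux item) of
`min_le_norm_clampField'`. [folklore] -/
theorem min_le_norm_clampField : ∀ {Gt ρ : ℝ → ℝ}, (∀ u, |u| ≤ 1 / 2 → Gt u = u) → (∀ u, 1 / 2 < |u| → 1 / 2 < |Gt u|) → (∀ t, 0 < ρ t) → ∀ (t : ℝ) (z : E3), min ‖z‖ (ρ t / 2) ≤ ‖(ρ t • (WithLp.toLp 2 fun k ↦ Gt ((ρ t)⁻¹ * z k) : E3))‖ :=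
  fun hGid hGgt hρ0 t z ↦ min_le_norm_clampField' hGid hGgt hρ0 t z

end Summit.FinalStateConjecture.FinalStateConjecture.Theorems

end
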